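import Mathlib.FieldTheory.Finite.Basic
import Mathlib.FieldTheory.IntermediateField.Adjoin.Basic
import Mathlib.FieldTheory.IsAlgClosed.AlgebraicClosure
import Mathlib.RingTheory.MvPolynomial.Basic
import Mathlib.Algebra.CharP.Frobenius
import Mathlib.GroupTheory.Perm.Fin
import HarnessLib

/-!
# Closing lemma toolkit (4): a Frobenius-twisted edge cycle gives a periodic arena path

Route `FrobeniusClosing`, support item `ClosingLemma` (stmt-ResolutionOfSingularities-16348).

The arena of `ClosingLemma`: pieces `V(Par j) ∖ V(g)`, `g ∈ Qar j`, polynomials over `ZMod p` in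
two blocks of `N` variables.  Suppose that over a field `F` algebraic over `ZMod p` we have blocks
`u 0, …, u r'` (`r' + 1` of them, indices in `Fin (r'+1)`, successor `finRotate`) and an exponent
`Qe = p ^ t` such that every pair `(u i, (u (i+1))^Qe)` is an edge of the arena.  Since the arena
is defined over `ZMod p`, Frobenius powers map edges to edges, so
`m ↦ (u (m mod (r'+1)))^(Qe^m)` is an infinite path; all its coordinates lie in the finite field
generated by the coordinates of `u`, on which a power of Frobenius is the identity, so the path is
periodic.  This is the last step of the closing round of the proof of `ClosingLemma`.

* `exists_pow_prime_pow_eq_self` — finitely many elements algebraic over `ZMod p` are fixed by a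
  common power `x ↦ x^(p^d)`, `d > 0`;
* `ringHom_aeval_zmod` — ring maps commute with evaluation of polynomials over `ZMod p`;
* `periodic_path_of_twisted_cycle` — the statement above, with the conclusion VERBATIM that of
  `Theses.FrobeniusClosing.ClosingLemma`.

OURS; elementary. [folklore]
-/

noncomputable section

-- single-problem summit: the doubled namespace component `ResolutionOfSingularities` is forced
set_option linter.dupNamespace false

open MvPolynomial

namespace Summit.ResolutionOfSingularities.ResolutionOfSingularities.Theorems.FrobeniusClosing.ClosingArena

/-! ## Frobenius bookkeeping -/

/-- **Finitely many elements algebraic over `𝔽_p` are fixed by a common Frobenius power**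
`x ↦ x^(p^d)` with `d > 0` (they generate a finite field of cardinality `p^d`). [folklore] -/
theorem exists_pow_prime_pow_eq_self (p : ℕ) [Fact p.Prime] {F : Type*} [Field F]
    [Algebra (ZMod p) F] [Algebra.IsAlgebraic (ZMod p) F] (s : Finset F) :
    ∃ d : ℕ, 0 < d ∧ ∀ x ∈ s, x ^ p ^ d = x := by
  classical
  set K := IntermediateField.adjoin (ZMod p) (s : Set F) with hK
  have hfd : FiniteDimensional (ZMod p) K :=
    IntermediateField.finiteDimensional_adjoin fun x _ => Algebra.IsIntegral.isIntegral x
  have hfin : Finite K := Module.finite_of_finite (ZMod p)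
  letI : Fintype K := Fintype.ofFinite K
  have hchar : CharP K p := charP_of_injective_algebraMap (algebraMap (ZMod p) K).injective p
  obtain ⟨n, _, hcard⟩ := FiniteField.card K p
  refine ⟨n, n.pos, fun x hx => ?_⟩
  have hxK : x ∈ K := IntermediateField.subset_adjoin _ _ hx
  have h := FiniteField.pow_card (⟨x, hxK⟩ : K)
  rw [hcard] at h
  have h' := congrArg (fun y : K => (y : F)) h
  simpa using h'

/-- Iterating: `x^(p^(d t)) = x` whenever `x^(p^d) = x`. [folklore] -/
theorem pow_prime_pow_mul_eq_self {F : Type*} [Monoid F] {p d : ℕ} {x : F} (hx : x ^ p ^ d = x)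
    (t : ℕ) : x ^ p ^ (d * t) = x := by
  induction t with
  | zero => simp
  | succ t ih => rw [Nat.mul_succ, pow_add, pow_mul, ih, hx]

/-- **Ring maps commute with evaluation of polynomials over `ZMod p`** (ring maps out of `ZMod p`
are unique). [folklore] -/
theorem ringHom_aeval_zmod {p : ℕ} {F F' : Type*} [CommRing F] [CommRing F'] [Algebra (ZMod p) F]
    [Algebra (ZMod p) F'] (ψ : F →+* F') {σ : Type*} (x : σ → F) (f : MvPolynomial σ (ZMod p)) :
    ψ (aeval x f) = aeval (ψ ∘ x) f := by
  have hcomp : ψ.comp (algebraMap (ZMod p) F) = algebraMap (ZMod p) F' := Subsingleton.elim _ _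
  rw [map_aeval, hcomp]
  rfl

/-- Successor (`finRotate`) of the residue class of `m` in `Fin (r'+1)` is the residue class of
`m + 1`. [folklore] -/
theorem finRotate_mk_mod (r' m : ℕ) :
    finRotate (r' + 1) ⟨m % (r' + 1), Nat.mod_lt _ r'.succ_pos⟩ =
      ⟨(m + 1) % (r' + 1), Nat.mod_lt _ r'.succ_pos⟩ := by
  rw [finRotate_apply]
  apply Fin.ext
  simp [Fin.val_add, Nat.add_mod]

/-- Residue classes in `Fin (r'+1)` are periodic with period `(r'+1) d`. [folklore] -/
theorem mk_mod_add_mul (r' m d : ℕ) :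
    (⟨(m + (r' + 1) * d) % (r' + 1), Nat.mod_lt _ r'.succ_pos⟩ : Fin (r' + 1)) =
      ⟨m % (r' + 1), Nat.mod_lt _ r'.succ_pos⟩ := by
  apply Fin.ext
  simp [Nat.add_mul_mod_self_left]

/-! ## The periodic path -/

/-- **A Frobenius-twisted edge cycle gives a periodic arena path over a finite field.**  Blocks
`u i` (`i : Fin (r'+1)`) over a field algebraic over `ZMod p`, an exponent `Qe = p^t`, and for each
`i` a piece `jj i` of the arena such that `(u i, (u (finRotate i))^Qe)` lies on `V(Par (jj i))` and
off some `g ∈ Qar (jj i)`; conclusion VERBATIM that of `Theses.FrobeniusClosing.ClosingLemma` for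
this arena: a periodic path over a finite field. [folklore] -/
theorem periodic_path_of_twisted_cycle (p : ℕ) [Fact p.Prime] (F : Type) [Field F]
    [Algebra (ZMod p) F] [Algebra.IsAlgebraic (ZMod p) F] {N k : ℕ}
    (Par Qar : Fin k → Finset (MvPolynomial (Fin N ⊕ Fin N) (ZMod p))) {r' : ℕ}
    (u : Fin (r' + 1) → Fin N → F) (t : ℕ) (jj : Fin (r' + 1) → Fin k)
    (hpos : ∀ i, ∀ f ∈ Par (jj i),
      aeval (Sum.elim (u i) (fun s => u (finRotate (r' + 1) i) s ^ p ^ t)) f = 0)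
    (hneg : ∀ i, ∃ g ∈ Qar (jj i),
      aeval (Sum.elim (u i) (fun s => u (finRotate (r' + 1) i) s ^ p ^ t)) g ≠ 0) :
    ∃ (K : Type) (_ : Field K) (_ : Algebra (ZMod p) K) (_ : Finite K) (w : ℕ → Fin N → K)
      (R : ℕ), 0 < R ∧ (∀ m, w (m + R) = w m) ∧
      ∀ m, ∃ j, (∀ f ∈ Par j, MvPolynomial.aeval (Sum.elim (w m) (w (m + 1))) f = 0) ∧
        ∃ g ∈ Qar j, MvPolynomial.aeval (Sum.elim (w m) (w (m + 1))) g ≠ 0 := by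
  classical
  -- the finite field generated by the coordinates
  set s₀ : Finset F := Finset.univ.image (fun c : Fin (r' + 1) × Fin N => u c.1 c.2) with hs₀
  obtain ⟨d, hd, hfix⟩ := exists_pow_prime_pow_eq_self p s₀
  have hus₀ : ∀ i s, u i s ∈ s₀ := fun i s => Finset.mem_image.2 ⟨(i, s), Finset.mem_univ _, rfl⟩
  set K := IntermediateField.adjoin (ZMod p) (s₀ : Set F) with hK
  have hfd : FiniteDimensional (ZMod p) K :=
    IntermediateField.finiteDimensional_adjoin fun x _ => Algebra.IsIntegral.isIntegral x
  have hfin : Finite K := Module.finite_of_finite (ZMod p)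
  have huK : ∀ i s, u i s ∈ K := fun i s => IntermediateField.subset_adjoin _ _ (hus₀ i s)
  -- the path in `F` and in `K`
  let y : ℕ → Fin N → F := fun m s => u ⟨m % (r' + 1), Nat.mod_lt _ r'.succ_pos⟩ s ^ (p ^ t) ^ m
  have hyK : ∀ m s, y m s ∈ K := fun m s => pow_mem (huK _ _) _
  let w : ℕ → Fin N → K := fun m s => ⟨y m s, hyK m s⟩
  refine ⟨K, inferInstance, inferInstance, hfin, w, (r' + 1) * d, Nat.mul_pos (Nat.succ_pos _) hd,
    ?_, ?_⟩
  · -- periodicity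
    intro m
    funext s
    apply Subtype.ext
    show y (m + (r' + 1) * d) s = y m s
    simp only [y]
    rw [mk_mod_add_mul, pow_add, pow_mul', ← pow_mul p]
    have hexp : t * ((r' + 1) * d) = d * (t * (r' + 1)) := by ring
    rw [hexp, pow_prime_pow_mul_eq_self (hfix _ (hus₀ _ _))]
  · -- edges: Frobenius powers of the given twisted edges
    intro m
    set i : Fin (r' + 1) := ⟨m % (r' + 1), Nat.mod_lt _ r'.succ_pos⟩ with hi
    -- the Frobenius power carrying edge `i` to edge `m`
    haveI : CharP F p := charP_of_injective_algebraMap (algebraMap (ZMod p) F).injective p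
    haveI : ExpChar F p := ExpChar.prime Fact.out
    set ψ : F →+* F := iterateFrobenius F p (t * m) with hψ
    have hψapply : ∀ x : F, ψ x = x ^ (p ^ t) ^ m := by
      intro x; rw [hψ, iterateFrobenius_def, pow_mul]
    have hedge : (⇑(algebraMap K F) ∘ Sum.elim (w m) (w (m + 1))) =
        ψ ∘ Sum.elim (u i) (fun s => u (finRotate (r' + 1) i) s ^ p ^ t) := by
      funext c
      rcases c with s | s
      · simp only [Function.comp_apply, Sum.elim_inl, hψapply]
        rfl
      · simp only [Function.comp_apply, Sum.elim_inr, hψapply]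
        show y (m + 1) s = _
        simp only [y]
        rw [hi, finRotate_mk_mod]
        conv_rhs => rw [← pow_mul, ← pow_succ']
    have htransfer : ∀ f : MvPolynomial (Fin N ⊕ Fin N) (ZMod p),
        algebraMap K F (aeval (Sum.elim (w m) (w (m + 1))) f) =
          ψ (aeval (Sum.elim (u i) (fun s => u (finRotate (r' + 1) i) s ^ p ^ t)) f) := by
      intro f
      rw [← aeval_algebraMap_apply, hedge, ringHom_aeval_zmod]
    refine ⟨jj i, fun f hf => ?_, ?_⟩
    · apply (algebraMap K F).injective
      rw [htransfer, hpos i f hf, map_zero, map_zero]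
    · obtain ⟨g, hg, hne⟩ := hneg i
      refine ⟨g, hg, fun h0 => hne ?_⟩
      have h1 := htransfer g
      rw [h0, map_zero] at h1
      exact ψ.injective (by rw [← h1, map_zero])

end Summit.ResolutionOfSingularities.ResolutionOfSingularities.Theorems.FrobeniusClosing.ClosingArena

end
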